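import Mathlib
import HarnessLib

/-!
# RiemannHypothesis / NbSectionTwoDyadic — the STEP-FUNCTION FORM of the Nyman–Beurling Gram sum

Support for the Assembly of route `NbSectionTwoDyadic` (item stmt-RiemannHypothesis-22784); pure
finite-sum algebra, route-independent (imports Mathlib only):

* `sum_sum_div_max_eq` — ABEL STEP: for any array `x`,
  `Σ_{m,n ≤ L} x_{mn}/max(m,n) = Σ_{k<L} (Σ_{m,n≤k} x_{mn})/(k(k+1)) + (Σ_{m,n≤L} x_{mn})/L`
  (`1/max(m,n) = Σ_{k ≥ max(m,n)} 1/(k(k+1))`, truncated at `L`);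
* `norm_sq_sum_eq_sum_sum_re` — `‖Σ c_m‖² = Σ_{m,n} Re(c_m c̄_n)`;
* `sectionTwoCoeff…` — the coefficients of `1 − ζ_2(s)·Σ_{n<N} a_n (n+1)^{-s}` as a Dirichlet
  polynomial of length `2N` and their partial sums `1 − Σ_n a_n min(2, ⌊k/(n+1)⌋)`;
* `weakDuality_identity` — `Σ W‖C‖² = Σ W‖C − R‖² + 2 Σ W R Re C − Σ W R²` (real `W, R`).

RH-free. No summit is proved by this file; nothing here bears on the truth of RH.
-/

noncomputable section

-- D-0017: `Summit.<S>.<S>.…` is the designed namespace of a single-problem summit.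
set_option linter.dupNamespace false

open scoped ComplexConjugate
open Complex Finset

namespace Summit.RiemannHypothesis.RiemannHypothesis.Theorems.NbSectionTwo

/-! ## The Abel step -/

/-- Peeling the last row and column off a double sum over `[1, L+1]²`. -/
theorem sum_sum_Icc_succ (L : ℕ) (y : ℕ → ℕ → ℝ) :
    ∑ m ∈ Icc 1 (L + 1), ∑ n ∈ Icc 1 (L + 1), y m n
      = ∑ m ∈ Icc 1 L, ∑ n ∈ Icc 1 L, y m n +
        (∑ m ∈ Icc 1 L, y m (L + 1) + ∑ n ∈ Icc 1 L, y (L + 1) n + y (L + 1) (L + 1)) := by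
  rw [Finset.sum_Icc_succ_top (by omega)]
  simp_rw [Finset.sum_Icc_succ_top (show 1 ≤ L + 1 by omega)]
  rw [Finset.sum_add_distrib]
  ring

/-- **Abel step**: for every real array `x` and every `L`,
`Σ_{m,n ∈ [1,L]} x_{mn} / max(m,n) = Σ_{k ∈ [1,L)} (Σ_{m,n ≤ k} x_{mn}) / (k(k+1)) + (Σ_{m,n ≤ L} x_{mn}) / L`.
[folklore] -/
theorem sum_sum_div_max_eq (L : ℕ) (x : ℕ → ℕ → ℝ) :
    ∑ m ∈ Icc 1 L, ∑ n ∈ Icc 1 L, x m n / ((max m n : ℕ) : ℝ)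
      = ∑ k ∈ Ico 1 L, (∑ m ∈ Icc 1 k, ∑ n ∈ Icc 1 k, x m n) / ((k : ℝ) * (k + 1))
        + (∑ m ∈ Icc 1 L, ∑ n ∈ Icc 1 L, x m n) / L := by
  induction L with
  | zero => simp
  | succ L ih =>
    rw [sum_sum_Icc_succ L (fun m n => x m n / ((max m n : ℕ) : ℝ)), ih, sum_sum_Icc_succ L x]
    have hrow : ∑ m ∈ Icc 1 L, x m (L + 1) / ((max m (L + 1) : ℕ) : ℝ)
        = (∑ m ∈ Icc 1 L, x m (L + 1)) / ((L : ℝ) + 1) := by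
      rw [Finset.sum_div]
      refine Finset.sum_congr rfl fun m hm => ?_
      rw [Finset.mem_Icc] at hm
      rw [max_eq_right (by omega)]
      push_cast
      ring
    have hcol : ∑ n ∈ Icc 1 L, x (L + 1) n / ((max (L + 1) n : ℕ) : ℝ)
        = (∑ n ∈ Icc 1 L, x (L + 1) n) / ((L : ℝ) + 1) := by
      rw [Finset.sum_div]
      refine Finset.sum_congr rfl fun n hn => ?_
      rw [Finset.mem_Icc] at hn
      rw [max_eq_left (by omega)]
      push_cast
      ring
    rw [hrow, hcol, max_self]
    rcases Nat.eq_zero_or_pos L with hL | hL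
    · subst hL
      simp
    · rw [Finset.sum_Ico_succ_top hL]
      push_cast
      have hL' : (L : ℝ) ≠ 0 := by exact_mod_cast hL.ne'
      field_simp
      ring

/-- `‖Σ_{m∈s} c_m‖² = Σ_{m,n∈s} Re(c_m c̄_n)`. [folklore] -/
theorem norm_sq_sum_eq_sum_sum_re (s : Finset ℕ) (c : ℕ → ℂ) :
    ‖∑ m ∈ s, c m‖ ^ 2 = ∑ m ∈ s, ∑ n ∈ s, (c m * conj (c n)).re := by
  rw [← Complex.normSq_eq_norm_sq, ← Complex.ofReal_re (normSq _), ← Complex.mul_conj, map_sum,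
    Finset.sum_mul_sum, Complex.re_sum]
  refine Finset.sum_congr rfl fun m _ => ?_
  rw [Complex.re_sum]

/-! ## The coefficients of `1 − ζ_2 · A` -/

/-- The generator pattern: `[j ≤ k] + [2j ≤ k] = min(2, ⌊k/j⌋)` (`j ≥ 1`). -/
theorem ite_add_ite_eq_min (j k : ℕ) (hj : 0 < j) :
    ((if j ≤ k then 1 else 0) + (if 2 * j ≤ k then 1 else 0) : ℕ) = min 2 (k / j) := by
  by_cases h1 : j ≤ k
  · by_cases h2 : 2 * j ≤ k
    · have : 2 ≤ k / j := (Nat.le_div_iff_mul_le hj).2 h2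
      rw [if_pos h1, if_pos h2, min_eq_left this]
    · have h3 : k / j = 1 := Nat.div_eq_of_lt_le (by omega) (by omega)
      rw [if_pos h1, if_neg h2, h3]
      rfl
  · have h3 : k / j = 0 := Nat.div_eq_of_lt (by omega)
    have h2 : ¬ 2 * j ≤ k := by omega
    rw [if_neg h1, if_neg h2, h3]
    rfl

/-- **The Dirichlet coefficients of `1 − ζ_2(s) A(s)`**: with
`c_m = [m = 1] − Σ_n a_n ([m = n+1] + [m = 2(n+1)])`,
`Σ_{m ∈ [1, 2N]} c_m m^{-s} = 1 − (1 + 2^{-s}) Σ_{n<N} a_n (n+1)^{-s}` (`N ≥ 1`). [folklore] -/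
theorem sectionTwoCoeff_sum_cpow (N : ℕ) (hN : 1 ≤ N) (a : Fin N → ℂ) (s : ℂ) :
    ∑ m ∈ Icc 1 (2 * N), ((if m = 1 then (1 : ℂ) else 0) -
        ∑ n : Fin N, a n * ((if m = (n : ℕ) + 1 then (1 : ℂ) else 0) +
          (if m = 2 * ((n : ℕ) + 1) then (1 : ℂ) else 0))) * (m : ℂ) ^ (-s)
      = 1 - (1 + (2 : ℂ) ^ (-s)) * ∑ n : Fin N, a n * ((n : ℂ) + 1) ^ (-s) := by
  have h1 : (1 : ℕ) ∈ Icc 1 (2 * N) := by simp; omega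
  simp_rw [sub_mul, Finset.sum_sub_distrib, ite_mul, one_mul, zero_mul, Finset.sum_ite_eq' _ 1,
    if_pos h1, Nat.cast_one, Complex.one_cpow]
  congr 1
  simp_rw [Finset.sum_mul]
  rw [Finset.sum_comm]
  conv_rhs => rw [Finset.mul_sum]
  refine Finset.sum_congr rfl fun n _ => ?_
  have hn1 : (n : ℕ) + 1 ∈ Icc 1 (2 * N) := by simp; omega
  have hn2 : 2 * ((n : ℕ) + 1) ∈ Icc 1 (2 * N) := by simp; omega
  have e : ∀ x ∈ Icc 1 (2 * N), a n * ((if x = (n : ℕ) + 1 then (1 : ℂ) else 0) +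
      (if x = 2 * ((n : ℕ) + 1) then (1 : ℂ) else 0)) * (x : ℂ) ^ (-s)
      = a n * (if x = (n : ℕ) + 1 then (x : ℂ) ^ (-s) else 0) +
        a n * (if x = 2 * ((n : ℕ) + 1) then (x : ℂ) ^ (-s) else 0) := by
    intro x _
    split_ifs <;> ring
  have h2 : ((2 * ((n : ℕ) + 1) : ℕ) : ℂ) ^ (-s) = (2 : ℂ) ^ (-s) * (((n : ℕ) : ℂ) + 1) ^ (-s) := by
    have := Complex.mul_cpow_ofReal_nonneg (show (0 : ℝ) ≤ 2 by norm_num)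
      (show (0 : ℝ) ≤ (n : ℕ) + 1 by positivity) (-s)
    push_cast at this ⊢
    exact this
  rw [Finset.sum_congr rfl e, Finset.sum_add_distrib, ← Finset.mul_sum, ← Finset.mul_sum,
    Finset.sum_ite_eq', Finset.sum_ite_eq', if_pos hn1, if_pos hn2, h2]
  push_cast
  ring

/-- **Partial sums of the coefficients**: for `k ≥ 1`,
`Σ_{m ≤ k} c_m = 1 − Σ_n a_n · min(2, ⌊k/(n+1)⌋)`. [folklore] -/
theorem sectionTwoCoeff_partial_sum (N : ℕ) (a : Fin N → ℂ) (k : ℕ) (hk : 1 ≤ k) :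
    ∑ m ∈ Icc 1 k, ((if m = 1 then (1 : ℂ) else 0) -
        ∑ n : Fin N, a n * ((if m = (n : ℕ) + 1 then (1 : ℂ) else 0) +
          (if m = 2 * ((n : ℕ) + 1) then (1 : ℂ) else 0)))
      = 1 - ∑ n : Fin N, a n * ((min 2 (k / ((n : ℕ) + 1)) : ℕ) : ℂ) := by
  have h1 : (1 : ℕ) ∈ Icc 1 k := by simp; omega
  rw [Finset.sum_sub_distrib, Finset.sum_ite_eq' _ 1, if_pos h1, Finset.sum_comm]
  congr 1
  refine Finset.sum_congr rfl fun n _ => ?_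
  rw [← Finset.mul_sum, Finset.sum_add_distrib, Finset.sum_ite_eq' _ ((n : ℕ) + 1),
    Finset.sum_ite_eq' _ (2 * ((n : ℕ) + 1)), ← ite_add_ite_eq_min _ k (Nat.succ_pos n)]
  simp only [Finset.mem_Icc]
  push_cast
  congr 2
  · by_cases h : (n : ℕ) + 1 ≤ k <;> simp [h]
  · by_cases h : 2 * ((n : ℕ) + 1) ≤ k <;> simp [h]

/-! ## Weak duality -/

/-- **Weak-duality identity**: for real weights `W`, real `R` and complex `C`,
`Σ W‖C‖² = Σ W‖C − R‖² + 2 Σ W R Re(C) − Σ W R²`. [folklore] -/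
theorem weakDuality_identity {ι : Type*} (s : Finset ι) (W R : ι → ℝ) (C : ι → ℂ) :
    ∑ i ∈ s, W i * ‖C i‖ ^ 2
      = ∑ i ∈ s, W i * ‖C i - R i‖ ^ 2 + 2 * ∑ i ∈ s, W i * R i * (C i).re
        - ∑ i ∈ s, W i * R i ^ 2 := by
  rw [Finset.mul_sum, ← Finset.sum_add_distrib, ← Finset.sum_sub_distrib]
  refine Finset.sum_congr rfl fun i _ => ?_
  rw [← Complex.normSq_eq_norm_sq, ← Complex.normSq_eq_norm_sq, Complex.normSq_sub,
    Complex.normSq_ofReal, Complex.conj_ofReal, Complex.re_mul_ofReal]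
  ring

end Summit.RiemannHypothesis.RiemannHypothesis.Theorems.NbSectionTwo

end
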